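import Summits.CriticalPhenomena.Ising3DConformalLimit.Theses.InverseSquareTelemetry
import Summits.CriticalPhenomena.Ising3DConformalLimit.Theses.PrecisionLaplacian
import Summits.CriticalPhenomena.Ising3DConformalLimit.Theses.PerfectScreening
import Summits.CriticalPhenomena.Ising3DConformalLimit.Theorems.PrecisionLaplacianMoebiusLimitOfTwoPointLawDyadicReduction
import Summits.CriticalPhenomena.Ising3DConformalLimit.Theorems.PrecisionLaplacianMoebiusLimitOfTwoPointLawLimitExistsEdge
import Summits.CriticalPhenomena.Ising3DConformalLimit.Theorems.GaussianLimitNotScreened.Negative.Reformulation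
import Literature.Probability.LatticeModels.CriticalTwoPointLawDimension
import Literature.Probability.LatticeModels.PointwiseScalingLimitScale
import HarnessLib

/-!
# Anatomy of the crux `InverseSquareTelemetry.TwoPointSpineComplement` (item stmt-CriticalPhenomena-4497):
# exactness certificates of line `registered` (`--supports stmt-CriticalPhenomena-4497`)

The crux (C) of route `InverseSquareTelemetry` reads: for every witness `(Δ, c)` of the isotropic pure power law
`⟨σ₀σ_x⟩_{β_c(3)}·|x|₂^{2Δ} → c > 0` (cofinite filter of `ℤ³`), there are `ρ > 0` on `(0,1]` and `S` with `0 < Δ`,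
`HasPointwiseScalingLimit (criticalCorr 3) ρ S`, `IsNondegenerateTwoPoint S`, `IsMoebiusCovariant Δ S`, `HasNontrivialU4 S`.
This THEOREM-ONLY file (no definitions, no `sorry`) records, as kernel-checked equivalences and implications BY NAME,
where the crux sits among the items of the sub-problem, so that the five stubs of the line's skeleton
(`Cruxes/TwoPointSpineComplement/Lines/birth.lean`: D₂, I₂, α′, β, γ) are seen to be an exact cover:

* `twoPointSpineComplement_iff_conjunct_of_law` — **(C) ↔ (item 0634 → `Ising3DConformalLimit`)**: the crux is literally
  "the summit conjunct GIVEN the two-point law"; the only content of "with THIS `Δ`" is the rigidity theorem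
  `scalingDimension_eq_of_twoPointLaw` (any scale-covariant non-degenerate pointwise limit has the dimension of the law).
* `twoPointSpineComplement_iff_moebius_and_nonGaussian` — **(C) ↔ `MoebiusLimitOfTwoPointLaw` (item 4801) ∧
  (item 0634 → `IsingEuclidUpgradeR4NonGaussian` (item 0636))**: the non-Gaussianity clause transfers between ANY two
  non-degenerate pointwise limits of `criticalCorr 3` (uniqueness up to one scale,
  `HasPointwiseScalingLimit.exists_scale_of_isNondegenerateTwoPoint` + `hasNontrivialU4_iff_of_scale`), so under the crux
  every non-degenerate limit — Möbius or not, any renormalisation — is non-Gaussian.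
* `twoPointSpineComplement_iff_dyadic_and_regimes` — **the exact residual of the skeleton**: (C) ↔ D₂ ∧ I₂ ∧ N, where
  D₂/I₂ are the skeleton's first two stubs verbatim (dyadic canonical existence / unit-inversion covariance of the even
  arities `n ≥ 4`, the landed factorisation `4801 ↔ D₂ ∧ I₂`) and N is the LAW-RESTRICTED non-Gaussianity of
  Möbius-covariant limits; `regimes_iff_window_split` splits N along the tree theorem `dimension_window_and_eta`
  (`Δ ∈ [1/2, 3/4]`) into the law-restricted corner/window/corner statements α′ (verbatim the skeleton's stub), β′, γ′ —
  the skeleton's β, γ are the same statements with the law hypothesis dropped (shared verbatim with the leaves of crux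
  stmt-13886), so the skeleton over-claims beyond (C) only by that hypothesis.
* Dependency edges by item name: `twoPointSpineComplement_of_open_items` ((C) ⇐ items 4738 `LimitExists`, 5352
  `FirstMultipoleIdentity`, 5353 `FarFieldClustering`, 0636), `twoPointSpineComplement_of_moebiusLimitExists_of_nonGaussian`
  ((C) ⇐ items 1344, 0636), `twoPointSpineComplement_of_ising3DConformalLimit` (the conjunct itself implies (C)), and the
  necessity edges `moebiusLimitOfTwoPointLaw_of_twoPointSpineComplement`, `limitExists_of_twoPointSpineComplement`,
  `nonGaussian_of_twoPointSpineComplement`.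

References: Duminil-Copin, ICM 2022, §8.1 p. 25 and §8.4 pp. 28–29 (status of existence / conformal covariance /
non-triviality on `ℤ³`); Aizenman, Comm. Math. Phys. 86 (1982) §1 (`U₄`). Nothing Ising-specific is proved here beyond
what the imports carry.
-/

noncomputable section

namespace Summit.CriticalPhenomena.Ising3DConformalLimit.InverseSquareTelemetryTwoPointSpineComplement.Anatomy

open Literature.Probability.LatticeModels Filter Topology EuclideanGeometry
open Summit.CriticalPhenomena.Ising3DConformalLimit.Theses
open Summit.CriticalPhenomena.Ising3DConformalLimit.Theses.InverseSquareTelemetry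
  (TwoPointSpineComplement IsingEuclidUpgradeR2RotInvPowerLaw)
open Summit.CriticalPhenomena.Ising3DConformalLimit.Theses.PrecisionLaplacian
  (MoebiusLimitOfTwoPointLaw IsingEuclidUpgradeR4NonGaussian)
open Summit.CriticalPhenomena.Ising3DConformalLimit.PrecisionLaplacianMoebiusLimitOfTwoPointLaw
  (moebiusLimitOfTwoPointLaw_of_dyadic dyadicLimit_of_moebiusLimitOfTwoPointLaw
    dyadicInversion_of_moebiusLimitOfTwoPointLaw moebiusLimitOfTwoPointLaw_of_limitExists)
open Summit.CriticalPhenomena.Ising3DConformalLimit.GaussianLimitNotScreenedNegative (dimension_window_and_eta)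

/-! ### Transfer of non-Gaussianity between pointwise limits -/

/-- **`U₄ ≢ 0` is a property of the lattice family, not of the limit chosen.** Two non-degenerate pointwise
scaling limits of `criticalCorr 3` (any two renormalisations, positive on `(0,1]`) are non-Gaussian simultaneously:
they differ by `c^n` on non-coincident configurations (`exists_scale_of_isNondegenerateTwoPoint`), and `U₄` scales by
`c⁴` (`hasNontrivialU4_iff_of_scale`). [folklore] -/
theorem hasNontrivialU4_transfer {ρ ρ' : ℝ → ℝ} {S S' : CorrFamily 3}
    (hρ : ∀ δ ∈ Set.Ioc (0:ℝ) 1, 0 < ρ δ) (hρ' : ∀ δ ∈ Set.Ioc (0:ℝ) 1, 0 < ρ' δ)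
    (hlim : HasPointwiseScalingLimit (criticalCorr 3) ρ S) (hlim' : HasPointwiseScalingLimit (criticalCorr 3) ρ' S')
    (hnd : IsNondegenerateTwoPoint S) (hnd' : IsNondegenerateTwoPoint S') (hU : HasNontrivialU4 S) :
    HasNontrivialU4 S' := by
  obtain ⟨c, hc, hscale⟩ :=
    HasPointwiseScalingLimit.exists_scale_of_isNondegenerateTwoPoint (d := 3) (by norm_num) hρ hρ' hlim hlim' hnd hnd'
  exact (hasNontrivialU4_iff_of_scale hc.ne' hscale).2 hU

/-! ### (C) is "the conjunct given the law" -/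

/-- **(C) ↔ (item 0634 → `Ising3DConformalLimit`).** `→`: apply the crux to the witness of item 0634 and forget
that the dimension is the law's. `←`: the conjunct offers SOME dimension `Δ'`; the two-point law with exponent `Δ`
forces `Δ' = Δ` (`scalingDimension_eq_of_twoPointLaw`). [folklore] -/
theorem twoPointSpineComplement_iff_conjunct_of_law :
    TwoPointSpineComplement ↔ (IsingEuclidUpgradeR2RotInvPowerLaw → _root_.Ising3DConformalLimit) := by
  constructor
  · rintro h ⟨Δ, c, hc, hP⟩
    obtain ⟨ρ, S, hρ, hΔ, hlim, hnd, hm, hU⟩ := h Δ c hc hP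
    exact ⟨ρ, Δ, S, hρ, hΔ, hlim, hnd, hm, hU⟩
  · intro h Δ c hc hP
    obtain ⟨ρ, Δ', S, hρ, hΔ', hlim, hnd, hm, hU⟩ := h ⟨Δ, c, hc, hP⟩
    have hEq : Δ' = Δ := scalingDimension_eq_of_twoPointLaw hc hP hlim hm.isScaleCovariant hnd
    subst hEq
    exact ⟨ρ, S, hρ, hΔ', hlim, hnd, hm, hU⟩

/-- The summit conjunct implies (C) outright (the law hypothesis is then idle). [folklore] -/
theorem twoPointSpineComplement_of_ising3DConformalLimit (h : _root_.Ising3DConformalLimit) :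
    TwoPointSpineComplement :=
  twoPointSpineComplement_iff_conjunct_of_law.2 fun _ => h

/-- (C) and item 0634 give the conjunct (the route's assembly step, isolated). [folklore] -/
theorem ising3DConformalLimit_of_twoPointSpineComplement (h : TwoPointSpineComplement)
    (hP : IsingEuclidUpgradeR2RotInvPowerLaw) : _root_.Ising3DConformalLimit :=
  twoPointSpineComplement_iff_conjunct_of_law.1 h hP

/-! ### (C) = Möbius complement of the law (item 4801) + non-Gaussianity under the law (0634 → 0636) -/

/-- **(C) → item 4801** (`MoebiusLimitOfTwoPointLaw`): forget `U₄`. [folklore] -/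
theorem moebiusLimitOfTwoPointLaw_of_twoPointSpineComplement (h : TwoPointSpineComplement) :
    MoebiusLimitOfTwoPointLaw := by
  rintro ⟨Δ, c, hc, hP⟩
  obtain ⟨ρ, S, hρ, hΔ, hlim, hnd, hm, -⟩ := h Δ c hc hP
  exact ⟨ρ, Δ, S, hρ, hΔ, hlim, hnd, hm⟩

/-- **(C) → (item 0634 → item 0636)**: under the crux and the law, EVERY non-degenerate pointwise limit of
`criticalCorr 3` (any renormalisation, no covariance asked) has `U₄ ≢ 0` — by transfer from the crux's witness.
[folklore] -/
theorem nonGaussian_of_twoPointSpineComplement (h : TwoPointSpineComplement)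
    (hP : IsingEuclidUpgradeR2RotInvPowerLaw) : IsingEuclidUpgradeR4NonGaussian := by
  intro ρ' S' hρ' hlim' hnd'
  obtain ⟨Δ, c, hc, hPc⟩ := hP
  obtain ⟨ρ, S, hρ, -, hlim, hnd, -, hU⟩ := h Δ c hc hPc
  exact hasNontrivialU4_transfer hρ hρ' hlim hlim' hnd hnd' hU

/-- **(C) → item 4738** (`WeylWindow.LimitExists`) under item 0634: bare existence is necessary. [folklore] -/
theorem limitExists_of_twoPointSpineComplement (h : TwoPointSpineComplement)
    (hP : IsingEuclidUpgradeR2RotInvPowerLaw) : WeylWindow.LimitExists := by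
  obtain ⟨Δ, c, hc, hPc⟩ := hP
  obtain ⟨ρ, S, hρ, -, hlim, hnd, -, -⟩ := h Δ c hc hPc
  exact ⟨ρ, S, hρ, hlim, hnd⟩

/-- **(C) ↔ item 4801 ∧ (item 0634 → item 0636).** `←`: item 4801 gives a Möbius-covariant non-degenerate limit
`(ρ, Δ', S)`; rigidity pins `Δ' = Δ`; item 0636 (under the law) gives `U₄ ≢ 0` for that `S`. (Header written
fully qualified on one line: it is the registered bookkeeping stub of this `--supports` file.) [folklore] -/
theorem twoPointSpineComplement_iff_moebius_and_nonGaussian : Summit.CriticalPhenomena.Ising3DConformalLimit.Theses.InverseSquareTelemetry.TwoPointSpineComplement ↔ (Summit.CriticalPhenomena.Ising3DConformalLimit.Theses.PrecisionLaplacian.MoebiusLimitOfTwoPointLaw ∧ (Summit.CriticalPhenomena.Ising3DConformalLimit.Theses.InverseSquareTelemetry.IsingEuclidUpgradeR2RotInvPowerLaw → Summit.CriticalPhenomena.Ising3DConformalLimit.Theses.PrecisionLaplacian.IsingEuclidUpgradeR4NonGaussian)) := by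
  constructor
  · exact fun h => ⟨moebiusLimitOfTwoPointLaw_of_twoPointSpineComplement h, nonGaussian_of_twoPointSpineComplement h⟩
  · rintro ⟨hM, hN⟩ Δ c hc hP
    obtain ⟨ρ, Δ', S, hρ, hΔ', hlim, hnd, hm⟩ := hM ⟨Δ, c, hc, hP⟩
    have hEq : Δ' = Δ := scalingDimension_eq_of_twoPointLaw hc hP hlim hm.isScaleCovariant hnd
    subst hEq
    exact ⟨ρ, S, hρ, hΔ', hlim, hnd, hm, hN ⟨Δ', c, hc, hP⟩ ρ S hρ hlim hnd⟩

/-! ### Dependency edges by item name -/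

/-- **(C) from the four open items 4738, 5352, 5353, 0636** (`WeylWindow.LimitExists →
PrimaryAtInfinity.FirstMultipoleIdentity → PrimaryAtInfinity.FarFieldClustering →
PrecisionLaplacian.IsingEuclidUpgradeR4NonGaussian → (C)`), through the landed edge
`moebiusLimitOfTwoPointLaw_of_limitExists` (items 5356/5357 of route PrimaryAtInfinity being theorems).
[cite: DuminilCopinICM2022, §8.4 p. 29] -/
theorem twoPointSpineComplement_of_open_items (hL : WeylWindow.LimitExists)
    (hM1 : PrimaryAtInfinity.FirstMultipoleIdentity) (hFC : PrimaryAtInfinity.FarFieldClustering)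
    (h0636 : IsingEuclidUpgradeR4NonGaussian) : TwoPointSpineComplement :=
  twoPointSpineComplement_iff_moebius_and_nonGaussian.2
    ⟨moebiusLimitOfTwoPointLaw_of_limitExists hL hM1 hFC, fun _ => h0636⟩

/-- **(C) from items 1344 and 0636** (`PerfectScreening.MoebiusLimitExists → IsingEuclidUpgradeR4NonGaussian → (C)`):
together they are the conjunct, which implies (C). [folklore] -/
theorem twoPointSpineComplement_of_moebiusLimitExists_of_nonGaussian (h1344 : PerfectScreening.MoebiusLimitExists)
    (h0636 : IsingEuclidUpgradeR4NonGaussian) : TwoPointSpineComplement := by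
  obtain ⟨ρ, Δ, S, hρ, hΔ, hlim, hnd, hm⟩ := h1344
  exact twoPointSpineComplement_of_ising3DConformalLimit ⟨ρ, Δ, S, hρ, hΔ, hlim, hnd, hm, h0636 ρ S hρ hlim hnd⟩

/-! ### The exact residual of the skeleton: `(C) ↔ D₂ ∧ I₂ ∧ N`, and the window split of `N` -/

/-- **(C) ↔ D₂ ∧ I₂ ∧ N.** D₂ = dyadic canonical existence of the even arities `n ≥ 4` under the law, I₂ =
unit-inversion covariance of every such dyadic limit (the skeleton's first two stubs verbatim; `4801 ↔ D₂ ∧ I₂` is the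
landed `moebiusLimitOfTwoPointLaw_iff_dyadicLimit_and_dyadicInversion`), N = under the law with exponent `Δ`, every
non-degenerate pointwise limit that is Möbius covariant WITH THAT `Δ` has `U₄ ≢ 0`. (`→` for N: transfer from the
crux's witness; `←`: 4801 from D₂+I₂, rigidity, N.) [folklore] -/
theorem twoPointSpineComplement_iff_dyadic_and_regimes :
    TwoPointSpineComplement ↔
      ((∀ Δ c : ℝ, 0 < c →
        Tendsto (fun x : Site 3 =>
          criticalTwoPoint 3 x * Real.sqrt (∑ i, ((x i : ℝ)) ^ 2) ^ (2 * Δ)) cofinite (nhds c) →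
        ∀ n, 4 ≤ n → Even n → ∃ Tn : (Fin n → EuclideanSpace ℝ (Fin 3)) → ℝ,
          TendstoLocallyUniformlyOn
            (fun k : ℕ => rescaledCorrelator (criticalCorr 3) (fun δ => δ ^ (-Δ)) n (((2:ℝ) ^ k)⁻¹))
            Tn atTop (NonCoincident 3 n)) ∧
      (∀ Δ c : ℝ, 0 < c →
        Tendsto (fun x : Site 3 =>
          criticalTwoPoint 3 x * Real.sqrt (∑ i, ((x i : ℝ)) ^ 2) ^ (2 * Δ)) cofinite (nhds c) →
        ∀ n, 4 ≤ n → Even n → ∀ Tn : (Fin n → EuclideanSpace ℝ (Fin 3)) → ℝ,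
          TendstoLocallyUniformlyOn
            (fun k : ℕ => rescaledCorrelator (criticalCorr 3) (fun δ => δ ^ (-Δ)) n (((2:ℝ) ^ k)⁻¹))
            Tn atTop (NonCoincident 3 n) →
          ∀ x ∈ NonCoincident 3 n, (∀ i, x i ≠ 0) →
            Tn (fun i => inversion 0 1 (x i)) = (∏ i, ‖x i‖ ^ (2 * Δ)) * Tn x) ∧
      (∀ Δ c : ℝ, 0 < c →
        Tendsto (fun x : Site 3 =>
          criticalTwoPoint 3 x * Real.sqrt (∑ i, ((x i : ℝ)) ^ 2) ^ (2 * Δ)) cofinite (nhds c) →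
        ∀ (ρ : ℝ → ℝ) (S : CorrFamily 3), (∀ δ ∈ Set.Ioc (0:ℝ) 1, 0 < ρ δ) →
          HasPointwiseScalingLimit (criticalCorr 3) ρ S → IsNondegenerateTwoPoint S →
          IsMoebiusCovariant Δ S → HasNontrivialU4 S)) := by
  constructor
  · intro h
    have hM := moebiusLimitOfTwoPointLaw_of_twoPointSpineComplement h
    refine ⟨dyadicLimit_of_moebiusLimitOfTwoPointLaw hM, dyadicInversion_of_moebiusLimitOfTwoPointLaw hM, ?_⟩
    intro Δ c hc hP ρ' S' hρ' hlim' hnd' _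
    obtain ⟨ρ, S, hρ, -, hlim, hnd, -, hU⟩ := h Δ c hc hP
    exact hasNontrivialU4_transfer hρ hρ' hlim hlim' hnd hnd' hU
  · rintro ⟨hD, hI, hN⟩ Δ c hc hP
    obtain ⟨ρ, Δ', S, hρ, hΔ', hlim, hnd, hm⟩ := moebiusLimitOfTwoPointLaw_of_dyadic hD hI ⟨Δ, c, hc, hP⟩
    have hEq : Δ' = Δ := scalingDimension_eq_of_twoPointLaw hc hP hlim hm.isScaleCovariant hnd
    subst hEq
    exact ⟨ρ, S, hρ, hΔ', hlim, hnd, hm, hN Δ' c hc hP ρ S hρ hlim hnd hm⟩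

/-- **Window split of N.** Under the law with exponent `Δ`, a Möbius-covariant non-degenerate pointwise limit of
`criticalCorr 3` exists only if `Δ ∈ [1/2, 3/4]` (`dimension_window_and_eta`: infrared bound + Duminil-Copin–Panis
2025 Thm 1.5), so N is equivalent to the conjunction of its three law-restricted regimes: the Coulomb corner
`Δ = 1/2` (α′, verbatim the skeleton's `stub_coulombCorner`), the open window `1/2 < Δ < 3/4` (β′) and the marginal
corner `Δ = 3/4` (γ′). The skeleton's stubs β, γ are β′, γ′ with the law hypothesis dropped. [folklore] -/
theorem regimes_iff_window_split :
    (∀ Δ c : ℝ, 0 < c →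
      Tendsto (fun x : Site 3 =>
        criticalTwoPoint 3 x * Real.sqrt (∑ i, ((x i : ℝ)) ^ 2) ^ (2 * Δ)) cofinite (nhds c) →
      ∀ (ρ : ℝ → ℝ) (S : CorrFamily 3), (∀ δ ∈ Set.Ioc (0:ℝ) 1, 0 < ρ δ) →
        HasPointwiseScalingLimit (criticalCorr 3) ρ S → IsNondegenerateTwoPoint S →
        IsMoebiusCovariant Δ S → HasNontrivialU4 S) ↔
    ((∀ c : ℝ, 0 < c →
      Tendsto (fun x : Site 3 =>
        criticalTwoPoint 3 x * Real.sqrt (∑ i, ((x i : ℝ)) ^ 2) ^ (2 * (1 / 2 : ℝ))) cofinite (nhds c) →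
      ∀ (ρ : ℝ → ℝ) (S : CorrFamily 3), (∀ δ ∈ Set.Ioc (0:ℝ) 1, 0 < ρ δ) →
        HasPointwiseScalingLimit (criticalCorr 3) ρ S → IsNondegenerateTwoPoint S →
        IsMoebiusCovariant (1 / 2) S → HasNontrivialU4 S) ∧
    (∀ Δ c : ℝ, 0 < c →
      Tendsto (fun x : Site 3 =>
        criticalTwoPoint 3 x * Real.sqrt (∑ i, ((x i : ℝ)) ^ 2) ^ (2 * Δ)) cofinite (nhds c) →
      1 / 2 < Δ → Δ < 3 / 4 →
      ∀ (ρ : ℝ → ℝ) (S : CorrFamily 3), (∀ δ ∈ Set.Ioc (0:ℝ) 1, 0 < ρ δ) →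
        HasPointwiseScalingLimit (criticalCorr 3) ρ S → IsNondegenerateTwoPoint S →
        IsMoebiusCovariant Δ S → HasNontrivialU4 S) ∧
    (∀ c : ℝ, 0 < c →
      Tendsto (fun x : Site 3 =>
        criticalTwoPoint 3 x * Real.sqrt (∑ i, ((x i : ℝ)) ^ 2) ^ (2 * (3 / 4 : ℝ))) cofinite (nhds c) →
      ∀ (ρ : ℝ → ℝ) (S : CorrFamily 3), (∀ δ ∈ Set.Ioc (0:ℝ) 1, 0 < ρ δ) →
        HasPointwiseScalingLimit (criticalCorr 3) ρ S → IsNondegenerateTwoPoint S →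
        IsMoebiusCovariant (3 / 4) S → HasNontrivialU4 S)) := by
  constructor
  · intro hN
    exact ⟨fun c hc hP => hN (1 / 2) c hc hP, fun Δ c hc hP _ _ => hN Δ c hc hP,
      fun c hc hP => hN (3 / 4) c hc hP⟩
  · rintro ⟨hα, hβ, hγ⟩ Δ c hc hP ρ S hρ hlim hnd hm
    obtain ⟨⟨h₁, h₂⟩, -⟩ := dimension_window_and_eta hρ hlim hnd hm.isScaleCovariant
    rcases h₁.eq_or_lt with h | h
    · subst h
      exact hα c hc hP ρ S hρ hlim hnd hm
    rcases h₂.lt_or_eq with h' | h'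
    · exact hβ Δ c hc hP h h' ρ S hρ hlim hnd hm
    · subst h'
      exact hγ c hc hP ρ S hρ hlim hnd hm

end Summit.CriticalPhenomena.Ising3DConformalLimit.InverseSquareTelemetryTwoPointSpineComplement.Anatomy

end
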